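import Summits.HodgeConjecture.HodgeConjecture.Theses.HeckePrymWeil
import Summits.HodgeConjecture.HodgeConjecture.Theses.AnchorTransport
import Summits.HodgeConjecture.HodgeConjecture.Theorems.HeckePrymWeilHodgeWeilOfWeilTransport
import Summits.HodgeConjecture.HodgeConjecture.Theorems.HeckePrymWeilHeckePrymAnchorsOfDeligneWeilFamily
import Literature.AlgebraicGeometry.HodgeTheory.WeilFamilyKAction
import HarnessLib.Audit

/-!
# Line `isotypic-unimodular-saturation` — skeleton r7 ("both stubs are route items, BY NAME") for crux `HeckePrymWeil.WeilTwelvefoldsSqrtMinus7`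
(item stmt-HodgeConjecture-1261, route route-HodgeConjecture-HeckePrymWeil; lead seat
`prover-line-stmt-HodgeConjecture-1261-c11-0`, 2026-08-16 — r7 RE-REGISTERED UNCHANGED by c11 (re-checked at route rev 20:
lean rc 0, 2 sorries = the 2 stubs; no worker-sized stub, wave none; outcome blocked-on stmt-HodgeConjecture-14497); r7 authored
by lead c10; r0 = planner's `Lines/isotypic-unimodular-saturation.lean`,
r1 = lead c2, r2 = lead c3 (CM anchor), r3 = lead c4 (tensor anchor, M3 + `WeilVariationalHodge` at `(7,6)`),
r4 = lead c5 (M3 + Weil transport `WT(7,6)`, composition `hodgeWeil_of_weilTransport_of_globalAction` p124583,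
tightness), r5 = lead c6 (stub 1 weakened M3 ⟶ M′ = `deligne1982_weilFamily_globalAction`), r6 = lead c8 (stub 1 :=
the route item stmt-HodgeConjecture-16866 spelled out verbatim, the route file rev 18 not yet rendering it))

RESHAPE r7 (lead c10, the planner's "optional r7" of `ROUTE-CHOICE-globalAction.md`, 22:20Z): since route rev 19/20
the route file RENDERS item stmt-HodgeConjecture-16866 as the decl
`Summit.HodgeConjecture.HodgeConjecture.Theses.HeckePrymWeil.DeligneWeilFamily`; r7 spells stub 1 as THAT DECL BY
NAME (its body is r6's stub 1 character for character, so every glue lemma of r6 applies by `δ`-unfolding and is kept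
verbatim), leaves stub 2 = `WT(7,6)` untouched, and adds the by-name cross-link `stubs_of_routeItems :
DeligneWeilFamily → WeilVariationalHodge → stub 1 ∧ stub 2`.  The crux-valued by-name closure
`DeligneWeilFamily → WeilVariationalHodge → WeilTwelvefoldsSqrtMinus7` is landed separately
(`Theorems/HeckePrymWeilWeilTwelvefoldsSqrtMinus7OfRouteItems.lean`, lead c10).  Text of r6 follows.

Crux (FIXED, the route's typing): on every complex abelian 12-fold `A` with `φ ≫ φ = -7` every
rational `(6,6)`-class in the typed Weil plane
`Eig((𝟙+φ)^*, (1+i√7)¹²) ⊔ Eig((𝟙+φ)^*, (1-i√7)¹²) ⊆ H¹²(A(ℂ); ℂ)` is algebraic.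

RESHAPE r6 (route-choice 2026-08-16T21:21Z, evidence `evidence-1261-route-choice.md` on the item: "LEAD: reshape
r6 — stub 1 := the item decl, drop the by-name kAction/levelStructure cross-links; stub 2 unchanged").  The
Literature apex behind r5's stub 1 — Deligne's abelian scheme with `K`-action through the target,
`deligne1982_weilFamily_kAction` (M‴) ⟹ `…_globalAction` (M′) — has been PROMOTED to the ROUTE ITEM
stmt-HodgeConjecture-16866 `HeckePrymWeil.DeligneWeilFamily` in its GLOBAL-CLASS RENDERING: the continuous
section `σ` of `FiberClass f (2k)` through `e^{-1 *} c` is replaced by a GLOBAL class `W ∈ H^{2k}(𝒳(ℂ); ℂ)`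
with `W|_{𝒳_{s₁}} = e^{-1 *} c`, and `IsQuasiProjectiveOver S` is inlined; every other clause is verbatim
M‴.  r6 therefore registers

* `stub_deligneWeilFamily` = the signature of item stmt-HodgeConjecture-16866 VERBATIM (closes by name when
  that item closes; the route file rev 18 does not yet render the decl, so the statement is spelled out), and
* `stub_weilTransport6` = `WT(7,6)` (UNCHANGED since r4): variational Hodge, along smooth projective families of
  relative dimension 12 over smooth irreducible bases, for global classes whose fibre restrictions are
  rational of type `(6,6)` AND lie, through a chart `e' : A' ≅ 𝒳_s` of a `√-7`-abelian twelvefold at EVERY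
  fibre, in the strong Weil plane `weilClassesOf A' φ' 6 7`; implied by the route item
  stmt-HodgeConjecture-14497 `WeilVariationalHodge` at `M = 6` (`stub_weilTransport6_of_weilVariationalHodge`),

with the sorry-free GLUE `kAction_of_stub_deligneWeilFamily` (σ := `globalSection f (2k) W`: continuity
`continuous_globalSection`, base point `rfl`, value at `s₁` from `W|_{s₁} = e^{-1 *} c` by
`FiberClass.mk_eq_mk_iff`) ⟹ M‴ ⟹ M′ (`deligne1982_weilFamily_globalAction_of_kAction`, tree) feeding the
landed composition `hodgeWeil_of_weilTransport_of_globalAction` (p124583) VERBATIM, and r4's tightness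
(`stub_weilTransport6_of_crux`) intact.  AFTER r6 BOTH STUBS ARE ROUTE ITEMS: stub 1 = stmt-16866 verbatim,
stub 2 ⟸ stmt-14497; modulo stub 1 the crux is EQUIVALENT to stub 2 (`crux_iff_stub_weilTransport6`).
wave: none — 2 stubs, both external leaves carried by their own items (16866: Lean-XL construction of the
universal polarized abelian scheme with `ℤ[√-p]`-action / its CM–tensor point; 14497: open mathematics).
-/

noncomputable section

set_option linter.dupNamespace false

open CategoryTheory AlgebraicGeometry Limits MonoidalCategory CartesianMonoidalCategory
open Literature.AlgebraicGeometry Literature.AlgebraicGeometry.Motives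
  Literature.AlgebraicGeometry.HodgeTheory Literature.AlgebraicTopology.SingularHomology
open Summit.HodgeConjecture.HodgeConjecture.Theorems.HeckePrymWeilLine
  (hodgeWeil_of_weilTransport_of_globalAction weilTransport_of_hodgeWeil weilTransport_of_transport)

namespace Summit.HodgeConjecture.HodgeConjecture.Cruxes.WeilTwelvefoldsSqrtMinus7.IsotypicUnimodularSaturation

/-! ### The two registered stubs of r7 -/

/-- **Stub 1 (r7) — REACH + ANCHOR = DELIGNE'S WEIL FAMILY THROUGH `X`, the route item
stmt-HodgeConjecture-16866, spelled as the route decl `HeckePrymWeil.DeligneWeilFamily` BY NAME** (global-class rendering of the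
Literature named fact `deligne1982_weilFamily_kAction`): for `p ≡ 3 (4)` prime `≥ 7`, `k ≥ 1`, a
`√-p`-abelian `2k`-fold `(X, Φ)` and a non-zero rational `(k,k)` class `c` of its strong Weil plane — a
smooth projective family `f : 𝒳 → S` of relative dimension `2k`, closed in `ℙᴺ × S`, over a smooth
irreducible quasi-projective base; a GLOBAL endomorphism `g` of `𝒳` over `S` (the `√-p`);
`e : X ≅ 𝒳_{s₁}` intertwining `Φ` and `g`; at EVERY `s` an abelian chart `(A', φ', e')`, `φ' ≫ φ' = -p`,
intertwining `g`; a GLOBAL class `W` with `W|_{𝒳_{s₁}} = e^{-1 *} c`; and a fibre `Y ≅ 𝒳_{s₀}` (chart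
intertwining `Ψ`, `g`) with an isogeny pair towards the tensor point `(A₁ × A₁, (x, y) ↦ (-p·y, x))`,
`dim A₁ = k`.  Classical: Deligne, LNM 900, proof of Thm. 4.8 (a)–(c), pp. 47–51 (universal polarized
abelian scheme with `𝒪_K`-action over a neat arithmetic quotient, algebraic by Baily–Borel/Borel; the
CM/tensor point of the component, van Geemen 5.3–5.7, André Lemme 6.3.3; flatness of the Weil classes,
`Γ ⊂ SU`, p. 50, globalised by the theorem of the fixed part).  Lean-XL (no moduli of abelian varieties,
no universal abelian scheme, no period map in Mathlib or the tree) — carried by its own item.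
[cite: Deligne1982HodgeCycles, proof of Thm. 4.8 (pp. 47–52), clauses (b), (c)]
[cite: vanGeemen1994HodgeAV, §5.3–5.11] [cite: Andre1996Motifs, Lemme 6.3.3] -/
theorem stub_deligneWeilFamily :
    Summit.HodgeConjecture.HodgeConjecture.Theses.HeckePrymWeil.DeligneWeilFamily := by
  sorry

/-- **Stub 2 (r6 = r5 = r4) — C⁺, WEIL TRANSPORT at `(7, 6)` (hardest; open).**  Let `f : 𝒳 ⟶ S` be a
smooth projective family of relative dimension `12` over a smooth irreducible `ℂ`-scheme and
`W ∈ H¹²(𝒳(ℂ); ℂ)` a class whose restriction to every fibre is rational of type `(6,6)` and lies, through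
a chart `e' : A' ≅ 𝒳_s` of an abelian twelvefold `A'` carrying `φ'` with `φ' ≫ φ' = -7`, in the strong
Weil plane `weilClassesOf A' φ' 6 7` (a FLAT WEIL CLASS of a `√-7`-twelvefold family).  If `W|_{s₀}` is
algebraic for ONE `s₀` then `W|_s` is algebraic for EVERY `s`.  The Weil-restricted instance of the route
crux `WeilVariationalHodge` (stmt-HodgeConjecture-14497) at `p = 7`, `M = 6`
(`stub_weilTransport6_of_weilVariationalHodge`), an instance of Grothendieck's variational Hodge
conjecture, implied by the Hodge conjecture — indeed by the crux itself (`stub_weilTransport6_of_crux`),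
André-motivated — irrefutable here.  No engine is claimed. [informal size XL; open]
[cite: Grothendieck1966, footnote 13] [cite: CharlesSchnell2014Notes, Conj. 11.3.1] -/
theorem stub_weilTransport6 :
    ∀ ⦃𝒳 S : SchemeOver ℂ⦄ (f : 𝒳 ⟶ S), IsSmoothProjectiveFamily f 12 →
      IrreducibleSpace S.left → AlgebraicGeometry.Smooth S.hom →
    ∀ (W : complexBetti 𝒳 12),
      (∀ s : ComplexPoints S, IsRationalClass (complexBetti.map (fiberι f s) 12 W) ∧
        IsOfHodgeType 12 (fiberOver f s) 12 6 6 (complexBetti.map (fiberι f s) 12 W)) →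
      (∀ s : ComplexPoints S, ∃ (A' : AbelianVariety ℂ) (φ' : A' ⟶ A') (e' : A'.X ≅ fiberOver f s),
        A'.dim = 12 ∧ φ' ≫ φ' = -((7 : ℤ) • 𝟙 A') ∧
        complexBetti.map e'.hom 12 (complexBetti.map (fiberι f s) 12 W) ∈ weilClassesOf A' φ' 6 7) →
      (∃ s₀ : ComplexPoints S,
        complexBetti.map (fiberι f s₀) 12 W ∈ algebraicClasses (fiberOver f s₀) 6) →
    ∀ s : ComplexPoints S, complexBetti.map (fiberι f s) 12 W ∈ algebraicClasses (fiberOver f s) 6 := by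
  sorry

/-! ### Glue (sorry-free): the route item's global class is a flat section — stub 1 ⟹ M‴ ⟹ M′ -/

/-- **Stub 1 ⟹ `deligne1982_weilFamily_kAction`** (the Literature apex M‴, charts-only package): the
global class `W` of the item restricts to the continuous section `σ := globalSection f (2k) W` of
`FiberClass f (2k)` (`continuous_globalSection`; `(σ s).pt = s` by `rfl`; `σ s₁ = ⟨s₁, e^{-1 *} c⟩` from
`W|_{𝒳_{s₁}} = e^{-1 *} c`), and `IsQuasiProjectiveOver S` is the inlined clause by definition — the tree's
theorem `kAction_of_deligneWeilFamily` (landed by the lead of the sibling crux `HeckePrymAnchors`,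
`Theorems/HeckePrymWeilHeckePrymAnchorsOfDeligneWeilFamily.lean`, whose one stub is this same item).
[cite: Deligne1982HodgeCycles, proof of Thm. 4.8 (pp. 47–52)] [cite: VoisinHodgeII2003, §3.1.2] -/
theorem kAction_of_stub_deligneWeilFamily (h₁ : type_of% stub_deligneWeilFamily) :
    Literature.AlgebraicGeometry.HodgeTheory.deligne1982_weilFamily_kAction :=
  Theorems.HeckePrymWeilLine.kAction_of_deligneWeilFamily h₁

/-- **Stub 1 ⟹ `deligne1982_weilFamily_globalAction`** (M′, what the composition reads): the tree's
theorem `deligne1982_weilFamily_globalAction_of_kAction` (balanced Weil type of every fibre recovered from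
the charts by Deligne's Prop. 4.4 and the transported Hodge–Riemann form) after
`kAction_of_stub_deligneWeilFamily`. [cite: Deligne1982HodgeCycles, proof of Thm. 4.8 with Prop. 4.4] -/
theorem globalAction_of_stub_deligneWeilFamily (h₁ : type_of% stub_deligneWeilFamily) :
    Literature.AlgebraicGeometry.HodgeTheory.deligne1982_weilFamily_globalAction :=
  deligne1982_weilFamily_globalAction_of_kAction (kAction_of_stub_deligneWeilFamily h₁)

/-! ### The composition (concludes the crux BY NAME; sorry-free glue) -/

/-- Stub 2 in the `2·6` shape consumed by `hodgeWeil_of_weilTransport_of_globalAction` at `(p, k) = (7, 6)`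
(the numerals `2·6 = 12`, `((7:ℕ):ℤ) = 7`; `weilClassesOf A' φ' 6 7` is literally the same). -/
theorem weilTransport_two_mul_six_of_stub (h₂ : type_of% stub_weilTransport6) :
    ∀ ⦃𝒳 S : SchemeOver ℂ⦄ (f : 𝒳 ⟶ S), IsSmoothProjectiveFamily f (2 * 6) →
      IrreducibleSpace S.left → AlgebraicGeometry.Smooth S.hom →
      ∀ (W : complexBetti 𝒳 (2 * 6)),
        (∀ s : ComplexPoints S, IsRationalClass (complexBetti.map (fiberι f s) (2 * 6) W) ∧
          IsOfHodgeType (2 * 6) (fiberOver f s) (2 * 6) 6 6 (complexBetti.map (fiberι f s) (2 * 6) W)) →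
        (∀ s : ComplexPoints S, ∃ (A' : AbelianVariety ℂ) (φ' : A' ⟶ A') (e' : A'.X ≅ fiberOver f s),
          A'.dim = 2 * 6 ∧ φ' ≫ φ' = -(((7 : ℕ) : ℤ) • 𝟙 A') ∧
          complexBetti.map e'.hom (2 * 6) (complexBetti.map (fiberι f s) (2 * 6) W) ∈
            weilClassesOf A' φ' 6 7) →
        (∃ s₀ : ComplexPoints S,
          complexBetti.map (fiberι f s₀) (2 * 6) W ∈ algebraicClasses (fiberOver f s₀) 6) →
        ∀ s : ComplexPoints S,
          complexBetti.map (fiberι f s) (2 * 6) W ∈ algebraicClasses (fiberOver f s) 6 := by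
  intro 𝒳 S f hf hirr hsm W hall hchart hanchor s
  have hchart' : ∀ s : ComplexPoints S, ∃ (A' : AbelianVariety ℂ) (φ' : A' ⟶ A')
      (e' : A'.X ≅ fiberOver f s), A'.dim = 12 ∧ φ' ≫ φ' = -((7 : ℤ) • 𝟙 A') ∧
      complexBetti.map e'.hom 12 (complexBetti.map (fiberι f s) 12 W) ∈ weilClassesOf A' φ' 6 7 := by
    intro s'
    obtain ⟨A', φ', e', hdim, hφ', hmem⟩ := hchart s'
    exact ⟨A', φ', e', hdim, by simpa using hφ', hmem⟩
  exact h₂ f hf hirr hsm W hall hchart' hanchor s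

/-- Conversely, the `2·6` shape gives Stub 2 (used for the tightness cross-links). -/
theorem stub_of_weilTransport_two_mul_six
    (h : ∀ ⦃𝒳 S : SchemeOver ℂ⦄ (f : 𝒳 ⟶ S), IsSmoothProjectiveFamily f (2 * 6) →
      IrreducibleSpace S.left → AlgebraicGeometry.Smooth S.hom →
      ∀ (W : complexBetti 𝒳 (2 * 6)),
        (∀ s : ComplexPoints S, IsRationalClass (complexBetti.map (fiberι f s) (2 * 6) W) ∧
          IsOfHodgeType (2 * 6) (fiberOver f s) (2 * 6) 6 6 (complexBetti.map (fiberι f s) (2 * 6) W)) →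
        (∀ s : ComplexPoints S, ∃ (A' : AbelianVariety ℂ) (φ' : A' ⟶ A') (e' : A'.X ≅ fiberOver f s),
          A'.dim = 2 * 6 ∧ φ' ≫ φ' = -(((7 : ℕ) : ℤ) • 𝟙 A') ∧
          complexBetti.map e'.hom (2 * 6) (complexBetti.map (fiberι f s) (2 * 6) W) ∈
            weilClassesOf A' φ' 6 7) →
        (∃ s₀ : ComplexPoints S,
          complexBetti.map (fiberι f s₀) (2 * 6) W ∈ algebraicClasses (fiberOver f s₀) 6) →
        ∀ s : ComplexPoints S,
          complexBetti.map (fiberι f s) (2 * 6) W ∈ algebraicClasses (fiberOver f s) 6) :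
    type_of% stub_weilTransport6 := by
  intro 𝒳 S f hf hirr hsm W hall hchart hanchor s
  have hchart' : ∀ s : ComplexPoints S, ∃ (A' : AbelianVariety ℂ) (φ' : A' ⟶ A')
      (e' : A'.X ≅ fiberOver f s), A'.dim = 2 * 6 ∧ φ' ≫ φ' = -(((7 : ℕ) : ℤ) • 𝟙 A') ∧
      complexBetti.map e'.hom (2 * 6) (complexBetti.map (fiberι f s) (2 * 6) W) ∈ weilClassesOf A' φ' 6 7 := by
    intro s'
    obtain ⟨A', φ', e', hdim, hφ', hmem⟩ := hchart s'
    exact ⟨A', φ', e', hdim, by simpa using hφ', hmem⟩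
  exact h f hf hirr hsm W hall hchart' hanchor s

/-- **The composition with the stubs as hypotheses, `Iff`-headed** (so that exactly ONE theorem of this file,
`WeilTwelvefoldsSqrtMinus7_of_stubs`, concludes the crux by name for the skeleton audit): MODULO STUB 1 (the route
item `DeligneWeilFamily`) THE CRUX IS EQUIVALENT TO STUB 2.  `←`: the landed composition
`hodgeWeil_of_weilTransport_of_globalAction` at `(p, k) = (7, 6)` VERBATIM, family package = M′ derived from stub 1
(`globalAction_of_stub_deligneWeilFamily`), Weil transport = stub 2; `→` (TIGHTNESS, no family structure needed:
chart, iso-invariance, typed ⊇ strong Weil plane): `weilTransport_of_hodgeWeil`.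
[cite: Deligne1982HodgeCycles, proof of Thm. 4.8] [cite: Grothendieck1966, footnote 13] [cite: vanGeemen1994HodgeAV, 4.9] -/
theorem crux_iff_stub_weilTransport6 (h₁ : type_of% stub_deligneWeilFamily) :
    Summit.HodgeConjecture.HodgeConjecture.Theses.HeckePrymWeil.WeilTwelvefoldsSqrtMinus7 ↔
      type_of% stub_weilTransport6 := by
  constructor
  · intro h
    refine stub_of_weilTransport_two_mul_six
      (weilTransport_of_hodgeWeil (p := 7) (k := 6) fun A φ hA hφ c hrat hH hW ↦ ?_)
    exact h A φ hA (by exact_mod_cast hφ) c hrat hH (by exact_mod_cast hW)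
  · intro h₂ A φ hA hφ c hrat hH hW
    exact hodgeWeil_of_weilTransport_of_globalAction (globalAction_of_stub_deligneWeilFamily h₁)
      (p := 7) (by norm_num) (by norm_num) le_rfl (k := 6) (by norm_num) (weilTransport_two_mul_six_of_stub h₂)
      A φ hA (by exact_mod_cast hφ) c hrat hH (by exact_mod_cast hW)

/-- **`WeilTwelvefoldsSqrtMinus7` from the two r6 stubs** — the skeleton theorem (concludes the crux BY NAME;
depends on the stubs' `sorry`s and on nothing else). -/
theorem WeilTwelvefoldsSqrtMinus7_of_stubs :
    Summit.HodgeConjecture.HodgeConjecture.Theses.HeckePrymWeil.WeilTwelvefoldsSqrtMinus7 :=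
  (crux_iff_stub_weilTransport6 stub_deligneWeilFamily).2 stub_weilTransport6

/-! ### Certified cross-links (sorry-free): the route items that carry the stubs -/

/-- **TIGHTNESS restated — the crux implies Stub 2** (from the `→` half; stub 1 is not used in that direction,
it is fed the registered stub only to instantiate the `Iff`). [cite: vanGeemen1994HodgeAV, 4.9] [cite: Fulton1998, §19.1] -/
theorem stub_weilTransport6_of_crux
    (h : Summit.HodgeConjecture.HodgeConjecture.Theses.HeckePrymWeil.WeilTwelvefoldsSqrtMinus7) :
    type_of% stub_weilTransport6 := by
  refine stub_of_weilTransport_two_mul_six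
    (weilTransport_of_hodgeWeil (p := 7) (k := 6) fun A φ hA hφ c hrat hH hW ↦ ?_)
  exact h A φ hA (by exact_mod_cast hφ) c hrat hH (by exact_mod_cast hW)

/-- **Stub 2 ⟸ `WeilVariationalHodge` (route item stmt-HodgeConjecture-14497) at `p = 7`, `M = 6`** —
forget the Weil clause (it supplies the `Nonempty (A'.X ≅ 𝒳_s)` clause). [cite: Grothendieck1966, footnote 13]
[cite: CharlesSchnell2014Notes, Conj. 11.3.1] -/
theorem stub_weilTransport6_of_weilVariationalHodge
    (hW : Summit.HodgeConjecture.HodgeConjecture.Theses.HeckePrymWeil.WeilVariationalHodge) :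
    type_of% stub_weilTransport6 :=
  stub_of_weilTransport_two_mul_six
    (weilTransport_of_transport (hW 7 (by norm_num) (by norm_num) le_rfl 6 (by norm_num)))

/-- **Stub 2 ⟸ `AnchorTransport.VariationalHodge`** (route AnchorTransport, item stmt-HodgeConjecture-1076):
forget the fibrewise Weil structures altogether. [cite: Grothendieck1966, footnote 13] -/
theorem stub_weilTransport6_of_variationalHodge
    (hV : Summit.HodgeConjecture.HodgeConjecture.Theses.AnchorTransport.VariationalHodge) :
    type_of% stub_weilTransport6 := by
  intro 𝒳 S f hf hirr hsm W hall _ hanchor s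
  exact hV f hf hirr hsm 6 W hall hanchor s

/-- **BOTH STUBS FROM THE TWO ROUTE ITEMS, BY NAME** (r7): stub 1 IS the route decl `DeligneWeilFamily`
(stmt-HodgeConjecture-16866), and stub 2 follows from the route decl `WeilVariationalHodge` (stmt-HodgeConjecture-14497);
hence the crux from the two items (`crux_iff_stub_weilTransport6`; the crux-valued by-name closure is landed in
`Theorems/HeckePrymWeilWeilTwelvefoldsSqrtMinus7OfRouteItems.lean`).
[cite: Deligne1982HodgeCycles, proof of Thm. 4.8] [cite: Grothendieck1966, footnote 13] -/
theorem stubs_of_routeItems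
    (hF : Summit.HodgeConjecture.HodgeConjecture.Theses.HeckePrymWeil.DeligneWeilFamily)
    (hW : Summit.HodgeConjecture.HodgeConjecture.Theses.HeckePrymWeil.WeilVariationalHodge) :
    (type_of% stub_deligneWeilFamily) ∧ (type_of% stub_weilTransport6) :=
  ⟨hF, stub_weilTransport6_of_weilVariationalHodge hW⟩

/-- **Stub 1 also closes the sibling crux `HeckePrymAnchors`** (stmt-HodgeConjecture-14496; its landed by-name
closure from the same decl is `heckePrymAnchors_of_deligneWeilFamilyDecl`). [cite: Deligne1982HodgeCycles, proof of Thm. 4.8] -/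
theorem heckePrymAnchors_of_stub_deligneWeilFamily (h₁ : type_of% stub_deligneWeilFamily) :
    Summit.HodgeConjecture.HodgeConjecture.Theses.HeckePrymWeil.HeckePrymAnchors :=
  Theorems.HeckePrymWeilLine.heckePrymAnchors_of_deligneWeilFamily h₁

end Summit.HodgeConjecture.HodgeConjecture.Cruxes.WeilTwelvefoldsSqrtMinus7.IsotypicUnimodularSaturation

end
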